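import Summits.QuantumFields.YangMills.Theorems.UnitScaleTiltHistoryTailLaneTail
import HarnessLib

/-!
# BC3 birth skeleton v5p8 = THE THIN RE-CUT of v5p7 REV 2 (5a70ea2d66d698c3, registry skeleton of record by OWNER RULING g20-№7 GO-3) over the LANDED consumer cone —
# crux `HistoryTailL` (route `UnitScaleTilt`, item stmt-QuantumFields-19936); pen ★ym-ust-18916-p1 g5, 2026-08-27; ns `…Cruxes.HistoryTailL.BirthV5p8`

v5p8 (this file): ONE stub {2′ `stub_laneRecordsV3`} (BYTE-IDENTICAL with v5p7 / v5p6 / 19935 v5j′) and a two-line composition: the whole consumer mathematics of K2-L is in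
the build — `Theorems/UnitScaleTiltHistoryTailLaneRows.lean` (p517763: 2″(b) `smallFactorLane_v3` ← ★alpha-1 p514512, (c) p513495, (d) p511457, 2‴ `windowedWeights_v3`),
`…LaneNumerator.lean` (p517775: Mechanism A joint event, root/exponent/mass budget, `setIntegral_up_le`, `budget_of_c`), `…LaneTail.lean` (`perPlaquetteHigh_lane`,
`perPlaquetteHighL_of_laneRecords`, **`historyTailL_of_laneRecords : (∀ L, Odd L → 1 < L → AlphaInputsT3ACv3Rec L) → …Theses.UnitScaleTilt.HistoryTailL`**), with 4c/4a at the
lane's constant `c = 1/(4N) = 1/8` (p515800 / p516492), 4b p511836, chessboard p481363, v4's tail chain (p442213, p438760, p432346).  So `HistoryTailL_of` :=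
`historyTailL_of_laneRecords stub_laneRecordsV3`: **19936 is PROVED modulo the lane's END theorem `AlphaInputsT3ACv3Rec` (NODE O's d = 3 (α) record) and nothing else.**
History of the line (v3b → v4 → v5p… → v5p7): see `Lines/birth_v5p7.lean`'s module docstring. [cite: Balaban1985UV3, (5) p.256, (41) p.266, (71) p.273 and Thm 2 p.272]
-/

set_option autoImplicit false

namespace Summit.QuantumFields.YangMills.Cruxes.HistoryTailL.BirthV5p8

/-! ## §1 Registered stub (the ONLY sorry) -/


/-- STUB 2′ (XXL, lane-owned = the END theorem of pub-balaban3d modulo NODE O; (β) rows = print's (55) with χ_{k+1} and (57), m(triv) = 1 (MassesPAC), Jacobian of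
`blockAvg ℰp` inside the step pieces at (46)-size ((19)–(20) p.261); E6′ is not a row; replaces v2's `AlphaInputsT3ACv2Rec` retired by P-g18-1; text = REBASE-CHECKLIST's, shared
byte-identically with 19935 v5i.  OWNER RULING g17-№1 §C / g17-№2 (2) / g18-№3 §4; IN PRINT modulo Bałaban CMP 95–99/102 = NODE O's object at d = 3, run with the power-counting
profile as a PARAMETER) — BAŁABAN'S (α) INPUT ROWS HOLD FOR THE PINNED CARRIER AT EVERY SUFFICIENTLY LARGE PROFILE: for every admissible block size there are
thresholds `(b₁, p₁)` such that every profile `(b₀, p₀) ⪰ (b₁, p₁)` is the profile of SOME primitive-constants record `𝔠 : AlphaConsts L 2` (`𝔠.b₀ = b₀`,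
`𝔠.p₀ = p₀`) with [7]-constants `a₀ a₁` bound with the record, whose v2 AC (α) rows `AlphaInputsT3AC.OfV3At F 𝔠 a₀ a₁` hold for every family with `F.L = L` —
★alpha-1's LANDED closed Prop `Theorems.AlphaInputsT3ACv3Rec L` (p481577) BY NAME.  SHARED verbatim with the `FluctuationComparisonRegPrL` (stmt-QuantumFields-19935)
skeleton v5h. [cite: Balaban1985UV3, Thm 1 p.257, (7) p.257 and Thm 2 p.272] -/
theorem stub_laneRecordsV3 : ∀ L : ℕ, Odd L → 1 < L → Summit.QuantumFields.YangMills.Theorems.AlphaInputsT3ACv3Rec L := by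
  sorry

/-! ## §2 The crux BY NAME — no sorry below this line -/

/-- **`HistoryTailL ⇐ stub_laneRecordsV3`**: the landed conditional closer `HistoryTailLaneTail.historyTailL_of_laneRecords` applied to STUB 2′ — the v3′ load-bearing item
stmt-QuantumFields-19936 BY NAME. [cite: Balaban1985UV3, (5) p.256 and (71) p.273; King1986, (3.12) p.657] -/
theorem HistoryTailL_of : Summit.QuantumFields.YangMills.Theses.UnitScaleTilt.HistoryTailL :=
  Summit.QuantumFields.YangMills.Theorems.HistoryTailLaneTail.historyTailL_of_laneRecords stub_laneRecordsV3

end Summit.QuantumFields.YangMills.Cruxes.HistoryTailL.BirthV5p8
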